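import Summits.ValiantsHypothesis.ValiantsHypothesis.Theorems.DualUnipotentThreeHalves.Negative.ThinWildFalse

/-!
# Conjecture (Iν) of `Cruxes/DualUnipotentThreeHalves/IotaNu.lean` is false (Negative lane, supports stmt-24318)

val-idea-crit-7 g0 (critic of record, director-valiant b124 WAVE-2).  The typed Conjecture (Iν) / PREREG-Q6 candidate
filed by val-idea-26 (`Cruxes/DualUnipotentThreeHalves/IotaNu.lean`, SEEDSPEC-krylov-seed §7):
«`ν² · dim W ≤ C m² + c ν² m` for every irreducible nilpotent `W ⊆ M_m(ℂ)` with an element of index `≥ ν`»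
is REFUTED — for every pair of constants — by the tree's thin-wild killer `L′_k ⊂ M_{3k}(ℂ)`
(`ThinWildFamily`, `ThinWildFalse.exists_Lfin`): irreducible, nilpotent, an element with `N^{2k} ≠ 0`, `dim ≥ k²`;
at `m = 3k`, `ν = 2k+1` the left side is `≥ 4k⁴`, the right side `≤ 9Ck² + 27ck³`.  The sharp form (`C = c = 1`) already
fails at `k = 4` (`M₁₂`, `ν = 9`, `dim ≥ 16`: `81·16 > 144 + 81·12`).
The four definitions below are VERBATIM copies of those in `IotaNu.lean` (a Cruxes work file cannot be imported here),
under this file's namespace.  Consequence for the R2 dossier: «fat ∧ high-index ∧ irreducible» nilpotent spaces EXIST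
(and the known ones, L_k / L′_k, are weight-flag cheap), so no residual-class description of `HeavyTopLaw` may assume
their absence.  Nothing here bears on `HeavyTopLaw` / 24318 itself; VP ≠ VNP is NOT proved.
-/

set_option linter.dupNamespace false

open Matrix

namespace Summit.ValiantsHypothesis.ValiantsHypothesis.Theorems.DualUnipotentThreeHalvesNegative.IotaNu

variable {m : ℕ}

/-! ## Definitions (verbatim from `Cruxes/DualUnipotentThreeHalves/IotaNu.lean`, val-idea-26 g0) -/
/-- `W ⊆ M_m(ℂ)` is a space of nilpotent matrices (`A^m = 0`). -/
def IsNilpotentSpace (W : Submodule ℂ (Matrix (Fin m) (Fin m) ℂ)) : Prop :=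
  ∀ A ∈ W, A ^ m = 0
/-- `W` is irreducible: no proper non-zero subspace of `ℂ^m` is invariant under every member. -/
def IsIrreducibleSpace (W : Submodule ℂ (Matrix (Fin m) (Fin m) ℂ)) : Prop :=
  ∀ U : Submodule ℂ (Fin m → ℂ), (∀ A ∈ W, ∀ u ∈ U, A *ᵥ u ∈ U) → U = ⊥ ∨ U = ⊤
/-- some member of `W` has `A^{ν-1} ≠ 0` (index `≥ ν`). -/
def HasIndexGe (W : Submodule ℂ (Matrix (Fin m) (Fin m) ℂ)) (ν : ℕ) : Prop :=
  ∃ A ∈ W, A ^ (ν - 1) ≠ 0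
/-- Conjecture (Iν), existential-constants form (FALSE: `not_iotaNuConjecture`). -/
def IotaNuConjecture : Prop :=
  ∃ C c : ℕ, ∀ (m ν : ℕ), 1 ≤ ν → ∀ W : Submodule ℂ (Matrix (Fin m) (Fin m) ℂ),
    IsNilpotentSpace W → IsIrreducibleSpace W → HasIndexGe W ν →
      ν ^ 2 * Module.finrank ℂ W ≤ C * m ^ 2 + c * ν ^ 2 * m
/-- Conjecture (Iν), sharp form `C = c = 1` (FALSE: `not_iotaNuConjectureSharp`). -/
def IotaNuConjectureSharp : Prop :=
  ∀ (m ν : ℕ), 1 ≤ ν → ∀ W : Submodule ℂ (Matrix (Fin m) (Fin m) ℂ),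
    IsNilpotentSpace W → IsIrreducibleSpace W → HasIndexGe W ν →
      ν ^ 2 * Module.finrank ℂ W ≤ m ^ 2 + ν ^ 2 * m

/-- packaging: `L′_k` satisfies the three hypotheses of (Iν) with `m = 3k`, `ν = 2k+1`, and has `finrank ≥ k²`. -/
theorem witness (k : ℕ) (hk : 1 ≤ k) : ∃ W : Submodule ℂ (Matrix (Fin (3 * k)) (Fin (3 * k)) ℂ),
    IsNilpotentSpace W ∧ IsIrreducibleSpace W ∧ HasIndexGe W (2 * k + 1) ∧ k ^ 2 ≤ Module.finrank ℂ W := by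
  obtain ⟨L', hnil, hirr, ⟨M, hM, hMpow⟩, hidx, hdim⟩ :=
    Summit.ValiantsHypothesis.ValiantsHypothesis.Theorems.DualUnipotentThreeHalvesNegative.ThinWild.exists_Lfin k hk
  refine ⟨L', ?_, ?_, ⟨M, hM, by simpa using hMpow⟩, hdim⟩
  · intro A hA
    exact pow_eq_zero_of_le (by omega) (hidx A hA)
  · intro U hU
    exact hirr U (fun A hA u hu => hU A hA u hu)

/-- The sharp form of (Iν) fails at `m = 12`, `ν = 9` on `L′_4`. -/
theorem not_iotaNuConjectureSharp : ¬ IotaNuConjectureSharp := by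
  intro h
  obtain ⟨W, h1, h2, h3, hdim⟩ := witness 4 (by norm_num)
  have := h (3 * 4) (2 * 4 + 1) (by norm_num) W h1 h2 h3
  norm_num at this
  omega

/-- Conjecture (Iν) fails for all constants `C, c`: take `k = 9C + 27c + 1`, `W = L′_k`. -/
theorem not_iotaNuConjecture : ¬ IotaNuConjecture := by
  rintro ⟨C, c, h⟩
  set k : ℕ := 9 * C + 27 * c + 1 with hk
  obtain ⟨W, h1, h2, h3, hdim⟩ := witness k (by omega)
  have hh := h (3 * k) (2 * k + 1) (by omega) W h1 h2 h3
  -- (2k+1)² · dim ≤ C (3k)² + c (2k+1)² (3k), dim ≥ k²  — impossible for k = 9C + 27c + 1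
  have hD : (2 * k + 1) ^ 2 * k ^ 2 ≤ (2 * k + 1) ^ 2 * Module.finrank ℂ W :=
    Nat.mul_le_mul_left _ hdim
  have h4 : 4 * k ^ 4 ≤ (2 * k + 1) ^ 2 * k ^ 2 := by nlinarith
  have h5 : C * (3 * k) ^ 2 ≤ k ^ 3 := by
    have : 9 * C ≤ k := by omega
    nlinarith
  have h6 : c * (2 * k + 1) ^ 2 * (3 * k) ≤ k ^ 4 := by
    have hc : 27 * c ≤ k := by omega
    have h7 : (2 * k + 1) ^ 2 ≤ 9 * k ^ 2 := by nlinarith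
    calc c * (2 * k + 1) ^ 2 * (3 * k) ≤ c * (9 * k ^ 2) * (3 * k) := by gcongr
      _ = 27 * c * k ^ 3 := by ring
      _ ≤ k * k ^ 3 := by gcongr
      _ = k ^ 4 := by ring
  have h8 : k ^ 3 ≤ k ^ 4 := Nat.pow_le_pow_right (by omega) (by omega)
  have h9 : 1 ≤ k := by omega
  have h10 : 0 < k ^ 4 := by positivity
  omega

end Summit.ValiantsHypothesis.ValiantsHypothesis.Theorems.DualUnipotentThreeHalvesNegative.IotaNu
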